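/-
Copyright (c) 2026 the pub-hodgecm-mathlib formalisation cell (harness21).  Prover seat hodgecm-mathlib-LH5-p05 (g6); dealer LH4-plan (g7) WORD #13 deal (i)
«BOREL NORMAL FORM, 2-FREE» (R1 amended: one object for (C2) and (C3c)), 2026-09-02.  Bodies = ★ `UnitaryThreeBorelCosetCount` §1 (A-p03 (g24)) verbatim, datum-free.
-/
import Literature.NumberTheory.Automorphic.UnitaryThreeDoubleCosetsHKDefs   -- ★ `flickerPH`, `mem_flickerPH_iff (h2 : (2:K) ≠ 0)`, `mem_flickerKH_iff`; brings ★ `exists_coe_eq_block_of_mem_centralizer`, `v_eq_one_of_coe_eq_block`, `mem_unitaryInt_iff_forall_v_apply_le_one`, `sum_rel_of_mem`, `mem_unitaryGroupOfForm_antidiagonal_iff_sum'`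
import HarnessLib

/-!
# Flicker's `P_H` in coordinates `(u, x, w)` — 2-FREE (datum-free twins of ★ `UnitaryThreeBorelCosetCount` §1)

Topic `NumberTheory/Automorphic` (half A line LH4, LAYER C of the (D-UNR) type-(1) column; dealer LH4-plan (g7) WORD #13 deal (i), R1 amended);
namespace `Literature.NumberTheory.Automorphic.UnitaryGroup` (= ★'s).  THEOREMS ONLY: no definition, no named fact, no instance, no notation, no `sorry`;
kernel lane `--supports stmt-HodgeConjecture-24833`; NOT an edition of ★ `UnitaryThreeBorelCosetCount` (that file is untouched; this one imports only
★ `UnitaryThreeDoubleCosetsHKDefs`).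

THE MATHEMATICS [Flicker1998UnitaryFL, Prop. 8 p. 84].  Every element of Flicker's `P_H` (★ `flickerPH` = `K_H ∩ B`, `c = diag(1, −1, 1)`) has matrix
`!![u, 0, u·x; 0, w, 0; 0, 0, (σu)⁻¹]` with `|u| = |w| = 1`, `σw·w = 1`, `x` integral and `σx = −x` (`exists_coe_eq_borel_of_mem_flickerPH'`), and conversely
(`exists_mem_flickerPH_coe_eq'`).  These are ★ `exists_coe_eq_borel_of_mem_flickerPH` ∕ ★ `exists_mem_flickerPH_coe_eq` (★ `UnitaryThreeBorelCosetCount` :52 ∕ :112)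
with the binder `(hd : LocalConjDatum σ ϖ)` — which ★ reads ONLY as `hd.v2 ⇒ (2 : K) ≠ 0` (:57 ∕ :117) and as `hd.σσ`, `hd.vσ` (:76 :79 :85 :89 :93, :119–:122, :143 :146;
census LH5-p05 (g6), no `hd.sqrt`, no other use of `|2| = 1`) — REPLACED by the datum-free tokens `(hσσ : ∀ x, σ (σ x) = x) (hvσ : ∀ x, Valued.v (σ x) = Valued.v x)
(h2 : (2 : K) ≠ 0)`.  Conclusions are byte-identical to ★; proofs are ★'s bodies verbatim minus the `have h2` line.  So BOTH frames call the same object: the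
symmetric-frame callers (★ `UnitaryThreePHTowerRho` ×7, ★ `UnitaryThreeFixedPointsFinite`) may pass `hd.σσ hd.vσ (2 ≠ 0 from hd.v2)`, the trace-frame LAYER C
files (C2) ∕ (C3c) pass `hd.σσ hd.vσ h2` from `UnramifiedLocalConjDatum` + the characteristic token T2 — `(2 : K) ≠ 0` is a CHARACTERISTIC hypothesis (free at
`L_w`, `char 0`), not `|2| = 1`: the unramified dyadic places are included.

HONEST LABEL: HC_CM is proved only modulo the 7 printed citations (2 remaining: hLiu418 = stmt-HodgeConjecture-24832, h413 = stmt-HodgeConjecture-24833) until rung 0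
closes; this file is count-neutral group bookkeeping over a valued field ((D-UNR) stays PRINT by D74′; LAYER C pays the type-(1) row in house only when it closes).

## References
* [Flicker1998UnitaryFL] Y. Z. Flicker, *Elementary proof of the fundamental lemma for a unitary group*, Canad. J. Math. 50 (1998), 74–98: Prop. 8 p. 84.
* [Rogawski1990] J. D. Rogawski, *Automorphic Representations of Unitary Groups in Three Variables* (1990), §1.9 p. 8, §4.9 p. 55.
-/

set_option autoImplicit false

open scoped MatrixGroups WithZero
open Matrix

namespace Literature.NumberTheory.Automorphic

namespace UnitaryGroup

open Literature.NumberTheory.Automorphic.HermitianLattice (unitaryInt mem_unitaryInt_iff)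

variable {K : Type*} [Field K] [Valued K ℤᵐ⁰]
  (σ : K →+* K) {J : Matrix (Fin 3) (Fin 3) K}

/-- `rev` on `Fin 3`. [folklore] -/ private theorem rev0' : Fin.rev (0 : Fin 3) = 2 := rfl
/-- `rev` on `Fin 3`. [folklore] -/ private theorem rev1' : Fin.rev (1 : Fin 3) = 1 := rfl
/-- `rev` on `Fin 3`. [folklore] -/ private theorem rev2' : Fin.rev (2 : Fin 3) = 0 := rfl

/-! ## §1 The elements of `P_H` in coordinates `(u, x, w)` — datum-free -/

/-- **Shape of `P_H`, 2-free** (twin of ★ `UnitaryThreeBorelCosetCount` :52 `exists_coe_eq_borel_of_mem_flickerPH`; `c = diag(1,−1,1)`; `(2 : K) ≠ 0` is a characteristic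
token (T2), no `|2| = 1`; `σ` an isometric involution — the two fields `hd.σσ`, `hd.vσ` ★ actually reads): an element of ★ `flickerPH` has matrix
`!![u, 0, u·x; 0, w, 0; 0, 0, (σu)⁻¹]` with `|u| = 1`, `|x| ≤ 1`, `σx = −x`, `|w| = 1`, `σw·w = 1` (Flicker p. 84: `P_H = {diag(u, ū⁻¹)·(1, λ√D; 0, 1)}` times the middle `E¹`).
[cite: Flicker1998UnitaryFL, Prop. 8 p. 84] -/
theorem exists_coe_eq_borel_of_mem_flickerPH' (hJ : J = (StdForm.antidiagonal 3).over K)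
    (hσσ : ∀ x, σ (σ x) = x) (hvσ : ∀ x, Valued.v (σ x) = Valued.v x) (h2 : (2 : K) ≠ 0)
    {c p : ↥(unitaryGroupOfForm σ J)} (hc : ((c : GL (Fin 3) K) : Matrix (Fin 3) (Fin 3) K) = !![1, 0, 0; 0, -1, 0; 0, 0, 1])
    (hp : p ∈ flickerPH σ J c) :
    ∃ u x w : K, ((p : GL (Fin 3) K) : Matrix (Fin 3) (Fin 3) K) = !![u, 0, u * x; 0, w, 0; 0, 0, (σ u)⁻¹] ∧
      Valued.v u = 1 ∧ Valued.v x ≤ 1 ∧ σ x = -x ∧ Valued.v w = 1 ∧ σ w * w = 1 := by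
  rw [mem_flickerPH_iff h2 hc, mem_flickerKH_iff] at hp
  obtain ⟨⟨hH, hK⟩, h20⟩ := hp
  obtain ⟨α, β, γ, δ, e, hblock⟩ := exists_coe_eq_block_of_mem_centralizer σ h2 hc hH
  have hγ : γ = 0 := by
    have : ((p : GL (Fin 3) K) : Matrix (Fin 3) (Fin 3) K) 2 0 = γ := by rw [hblock]; rfl
    rw [← this, h20]
  subst hγ
  -- unitarity relations
  have r02 := sum_rel_of_mem σ hJ p 0 2
  have r22 := sum_rel_of_mem σ hJ p 2 2
  have r11 := sum_rel_of_mem σ hJ p 1 1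
  rw [hblock] at r02 r22 r11
  simp only [Fin.sum_univ_three, rev0', rev1', rev2', Fin.isValue, if_true, show ¬ ((2 : Fin 3) = 0) by decide, if_false] at r02 r22 r11
  simp only [Matrix.of_apply, Matrix.cons_val', Matrix.cons_val_zero, Matrix.cons_val_one, Matrix.cons_val_fin_one, Matrix.cons_val,
    Matrix.empty_val', map_zero, mul_zero, zero_mul, add_zero, zero_add] at r02 r22 r11
  -- r02 : σ α * δ = 1 ; r22 : σ β * δ + σ δ * β = 0 ; r11 : σ e * e = 1
  have hα0 : α ≠ 0 := by
    intro h; rw [h, map_zero, zero_mul] at r02; exact zero_ne_one r02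
  have hσα0 : σ α ≠ 0 := fun h => hα0 (by rw [← hσσ α, h, map_zero])
  have hδ : δ = (σ α)⁻¹ := eq_inv_of_mul_eq_one_right r02
  -- integrality
  have hint := (mem_unitaryInt_iff_forall_v_apply_le_one σ hJ hvσ p).1 hK
  have hvα : Valued.v α ≤ 1 := by have := hint 0 0; rw [hblock] at this; exact this
  have hvβ : Valued.v β ≤ 1 := by have := hint 0 2; rw [hblock] at this; exact this
  have hvδ : Valued.v δ ≤ 1 := by have := hint 2 2; rw [hblock] at this; exact this
  have hvα1 : Valued.v α = 1 := by
    refine le_antisymm hvα ?_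
    rw [hδ, map_inv₀, hvσ] at hvδ
    by_contra hlt; push Not at hlt
    have : (1 : ℤᵐ⁰) < (Valued.v α)⁻¹ := one_lt_inv_iff₀.2 ⟨(Valuation.pos_iff _).2 hα0, hlt⟩
    exact absurd hvδ (not_le.2 this)
  refine ⟨α, β / α, e, ?_, hvα1, ?_, ?_, v_eq_one_of_coe_eq_block σ hJ hvσ hblock, r11⟩
  · rw [hblock, hδ, mul_div_cancel₀ _ hα0]
  · rw [map_div₀, hvα1, div_one]; exact hvβ
  · -- σ(β/α) = σβ/σα = σβ·δ = −σδ·β = −β/α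
    have hσδ : σ δ = α⁻¹ := by rw [hδ, map_inv₀, hσσ]
    rw [map_div₀, div_eq_mul_inv, ← hδ]
    rw [hσδ] at r22
    have : σ β * δ = -(α⁻¹ * β) := eq_neg_of_add_eq_zero_left r22
    rw [this, div_eq_mul_inv, mul_comm β]

omit [Valued K ℤᵐ⁰] in
/-- Constructor: a `3 × 3` matrix with non-zero determinant satisfying the nine unitarity relations is (the matrix of) an element of `U(σ, Φ₃)`
(a `private` re-proof of ★ `UnitaryThreeBorelCosetCount`'s private `exists_coe_eq_of_sum'`). [cite: Rogawski1990, §1.9 p. 8] -/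
private theorem exists_coe_eq_of_sum' (hJ : J = (StdForm.antidiagonal 3).over K) (M : Matrix (Fin 3) (Fin 3) K) (hdet : M.det ≠ 0)
    (hsum : ∀ a b : Fin 3, ∑ i, σ (M i a) * M (Fin.rev i) b = if b = Fin.rev a then 1 else 0) :
    ∃ g : ↥(unitaryGroupOfForm σ J), ((g : GL (Fin 3) K) : Matrix (Fin 3) (Fin 3) K) = M := by
  have hmem : Matrix.GeneralLinearGroup.mkOfDetNeZero M hdet ∈ unitaryGroupOfForm σ J := by
    rw [hJ, mem_unitaryGroupOfForm_antidiagonal_iff_sum']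
    simpa [Matrix.GeneralLinearGroup.val_mkOfDetNeZero] using hsum
  exact ⟨⟨_, hmem⟩, Matrix.GeneralLinearGroup.val_mkOfDetNeZero _ _⟩

/-- **Converse, 2-free** (twin of ★ `UnitaryThreeBorelCosetCount` :112 `exists_mem_flickerPH_coe_eq`; `c = diag(1,−1,1)`; `(2 : K) ≠ 0` is a characteristic token (T2), no
`|2| = 1`): the literal `!![u, 0, u·x; 0, w, 0; 0, 0, (σu)⁻¹]` with `|u| = |w| = 1`, `σw·w = 1`, `|x| ≤ 1`, `σx = −x` is an element of `P_H`.
[cite: Flicker1998UnitaryFL, Prop. 8 p. 84] -/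
theorem exists_mem_flickerPH_coe_eq' (hJ : J = (StdForm.antidiagonal 3).over K)
    (hσσ : ∀ x, σ (σ x) = x) (hvσ : ∀ x, Valued.v (σ x) = Valued.v x) (h2 : (2 : K) ≠ 0)
    {c : ↥(unitaryGroupOfForm σ J)} (hc : ((c : GL (Fin 3) K) : Matrix (Fin 3) (Fin 3) K) = !![1, 0, 0; 0, -1, 0; 0, 0, 1])
    {u x w : K} (hu : Valued.v u = 1) (hx : Valued.v x ≤ 1) (hσx : σ x = -x) (hw : Valued.v w = 1) (hσw : σ w * w = 1) :
    ∃ p : ↥(unitaryGroupOfForm σ J), p ∈ flickerPH σ J c ∧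
      ((p : GL (Fin 3) K) : Matrix (Fin 3) (Fin 3) K) = !![u, 0, u * x; 0, w, 0; 0, 0, (σ u)⁻¹] := by
  have hu0 : u ≠ 0 := fun h => by rw [h, map_zero] at hu; exact zero_ne_one hu
  have hσu0 : σ u ≠ 0 := fun h => hu0 (by rw [← hσσ u, h, map_zero])
  have hw0 : w ≠ 0 := fun h => by rw [h, map_zero] at hw; exact zero_ne_one hw
  have hσσu : σ (σ u) = u := hσσ u
  have hσσx : σ (σ x) = x := hσσ x
  have hdet : (!![u, 0, u * x; 0, w, 0; 0, 0, (σ u)⁻¹] : Matrix (Fin 3) (Fin 3) K).det ≠ 0 := by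
    rw [Matrix.det_fin_three]; simp [hu0, hσu0, hw0]
  have hsum : ∀ a b : Fin 3, ∑ i, σ ((!![u, 0, u * x; 0, w, 0; 0, 0, (σ u)⁻¹] : Matrix (Fin 3) (Fin 3) K) i a) *
      (!![u, 0, u * x; 0, w, 0; 0, 0, (σ u)⁻¹] : Matrix (Fin 3) (Fin 3) K) (Fin.rev i) b = if b = Fin.rev a then 1 else 0 := by
    intro a b
    fin_cases a <;> fin_cases b <;>
      simp [Fin.sum_univ_three, rev1', rev2', map_mul, map_inv₀, hσσu, hσx, hσu0, hu0, hσw]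
    field_simp
    ring
  obtain ⟨p, hp⟩ := exists_coe_eq_of_sum' σ hJ _ hdet hsum
  refine ⟨p, ?_, hp⟩
  rw [mem_flickerPH_iff h2 hc, mem_flickerKH_iff]
  refine ⟨⟨?_, ?_⟩, by rw [hp]; rfl⟩
  · -- commutes with `c = diag(1,−1,1)`
    rw [Subgroup.mem_centralizer_singleton_iff]
    apply Subtype.ext; apply Units.ext
    rw [Subgroup.coe_mul, Subgroup.coe_mul, Units.val_mul, Units.val_mul, hp, hc]
    ext i j
    fin_cases i <;> fin_cases j <;> simp [Matrix.mul_apply, Fin.sum_univ_three]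
  · -- integral
    rw [mem_unitaryInt_iff_forall_v_apply_le_one σ hJ hvσ]
    intro i j
    rw [hp]
    have hvσu : (Valued.v (σ u))⁻¹ ≤ 1 := by rw [hvσ, hu, inv_one]
    have hux : Valued.v u * Valued.v x ≤ 1 := by rw [hu, one_mul]; exact hx
    fin_cases i <;> fin_cases j <;> simp [hu.le, hw.le, hvσu, hux]

end UnitaryGroup

end Literature.NumberTheory.Automorphic
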